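import Mathlib

/-!
# Crux `LinnikCubicClassGroups.PureCubicClassNumberHard` (stmt-QuantumAdvantage-11826) —
# genus theory for `N = ℚ(ζ₃, ∛(pq)) / ℚ(ζ₃)`, part 1: the Galois bookkeeping

Line `Sketch` (honda-leak arm), towards the lead's stub `stub_ambiguousTrivial` (`3 ∤ h_N`).
Setting: a Galois number field `N` of degree `6`, `ζ ∈ N` with `ζ² + ζ + 1 = 0`, and an
automorphism `σ ≠ 1` with `σ ζ = ζ`.  Then `F = ℚ(ζ)` has degree `2`, `Gal(N/F) = ⟨σ⟩` has order
`3`, the `σ`-fixed elements of `N` are exactly `F`, `N/F` is a cyclic cubic extension whose norm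
is `x ↦ x · σx · σ²x` (so Hilbert 90 applies in the form: norm `1` ⟹ `x = y / σy`), and the
`σ`-fixed units of `𝓞 N` are the six roots of unity `±ζ^i` (units of `ℤ[ζ₃]`).
-/

set_option linter.dupNamespace false -- D-0017 (Summits/<S>/<S>/… by design)

namespace Summit.QuantumAdvantage.QuantumAdvantage.Theorems.LinnikCubicClassGroups

open NumberField IsDedekindDomain
open scoped IntermediateField nonZeroDivisors

variable {N : Type} [Field N] [NumberField N]

/-! ### The cube root of unity -/

/-- A root of `X² + X + 1` in characteristic `0` is a primitive cube root of unity. [folklore] -/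
theorem genus_isPrimitiveRoot {ζ : N} (hζ : ζ ^ 2 + ζ + 1 = 0) : IsPrimitiveRoot ζ 3 := by
  haveI : Fact (Nat.Prime 3) := ⟨Nat.prime_three⟩
  have h3 : ζ ^ 3 = 1 := by
    have : ζ ^ 3 - 1 = (ζ - 1) * (ζ ^ 2 + ζ + 1) := by ring
    rw [hζ, mul_zero, sub_eq_zero] at this
    exact this
  have h1 : ζ ≠ 1 := by
    rintro rfl
    norm_num at hζ
  have hord : orderOf ζ = 3 := orderOf_eq_prime h3 h1
  rw [← hord]
  exact IsPrimitiveRoot.orderOf ζ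

/-- `ζ³ = 1`. [folklore] -/
theorem genus_zeta_pow_three {ζ : N} (hζ : ζ ^ 2 + ζ + 1 = 0) : ζ ^ 3 = 1 :=
  (genus_isPrimitiveRoot hζ).pow_eq_one

/-- `ζ ≠ 1`. [folklore] -/
theorem genus_zeta_ne_one {ζ : N} (hζ : ζ ^ 2 + ζ + 1 = 0) : ζ ≠ 1 :=
  (genus_isPrimitiveRoot hζ).ne_one (by norm_num)

/-- `ζ ≠ 0`. [folklore] -/
theorem genus_zeta_ne_zero {ζ : N} (hζ : ζ ^ 2 + ζ + 1 = 0) : ζ ≠ 0 :=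
  (genus_isPrimitiveRoot hζ).ne_zero (by norm_num)

/-- `ℚ(ζ)` is a third cyclotomic extension of `ℚ` (for the canonical `ℚ`-algebra structure of the
field `ℚ(ζ)`, the one Mathlib's cyclotomic library speaks about). [folklore] -/
theorem genus_isCyclotomicExtension {ζ : N} (hζ : IsPrimitiveRoot ζ 3) :
    @IsCyclotomicExtension {3} ℚ ℚ⟮ζ⟯ _ _ DivisionRing.toRatAlgebra := by
  have h := hζ.intermediateField_adjoin_isCyclotomicExtension ℚ
  have e : (DivisionRing.toRatAlgebra : Algebra ℚ ℚ⟮ζ⟯) = ℚ⟮ζ⟯.algebra' := Subsingleton.elim _ _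
  rw [e]; exact h

/-- `𝓞 ℚ(ζ)` is a principal ideal ring (class number one of `ℚ(ζ₃)`, Mathlib). [folklore] -/
theorem genus_isPrincipalIdealRing {ζ : N} (hζ : IsPrimitiveRoot ζ 3) :
    IsPrincipalIdealRing (𝓞 ℚ⟮ζ⟯) :=
  @IsCyclotomicExtension.Rat.three_pid ℚ⟮ζ⟯ _ _ (genus_isCyclotomicExtension hζ)

/-- `[ℚ(ζ) : ℚ] = 2`. [folklore] -/
theorem genus_finrank_adjoin {ζ : N} (hζ : IsPrimitiveRoot ζ 3) : Module.finrank ℚ ℚ⟮ζ⟯ = 2 := by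
  haveI := hζ.intermediateField_adjoin_isCyclotomicExtension ℚ
  haveI := genus_isCyclotomicExtension hζ
  have h := IsCyclotomicExtension.finrank (n := 3) (K := ℚ) ℚ⟮ζ⟯
    (Polynomial.cyclotomic.irreducible_rat (by norm_num))
  have h3 : Nat.totient 3 = 2 := by decide
  rw [h3] at h
  convert h using 2

variable [IsGalois ℚ N]

/-- `[N : ℚ(ζ)] = 3` when `[N : ℚ] = 6`. [folklore] -/
theorem genus_finrank_top (hN : Module.finrank ℚ N = 6) {ζ : N} (hζ : IsPrimitiveRoot ζ 3) :
    Module.finrank ℚ⟮ζ⟯ N = 3 := by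
  have h := Module.finrank_mul_finrank ℚ ℚ⟮ζ⟯ N
  rw [genus_finrank_adjoin hζ, hN] at h
  omega

/-- `# Gal(N/ℚ(ζ)) = 3`. [folklore] -/
theorem genus_card_fixingSubgroup (hN : Module.finrank ℚ N = 6) {ζ : N} (hζ : IsPrimitiveRoot ζ 3) :
    Nat.card (ℚ⟮ζ⟯).fixingSubgroup = 3 := by
  rw [IsGalois.card_fixingSubgroup_eq_finrank, genus_finrank_top hN hζ]

omit [IsGalois ℚ N] in
/-- An automorphism fixing `ζ` fixes `ℚ(ζ)` pointwise. [folklore] -/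
theorem genus_mem_fixingSubgroup {ζ : N} {σ : N ≃ₐ[ℚ] N} (hσζ : σ ζ = ζ) :
    σ ∈ (ℚ⟮ζ⟯).fixingSubgroup := by
  rw [IntermediateField.mem_fixingSubgroup_iff]
  intro x hx
  have hle : ℚ⟮ζ⟯ ≤ IntermediateField.fixedField (Subgroup.zpowers σ) := by
    rw [IntermediateField.adjoin_simple_le_iff]
    rintro ⟨g, hg⟩
    have hst : Subgroup.zpowers σ ≤ MulAction.stabilizer (N ≃ₐ[ℚ] N) ζ :=
      (Subgroup.zpowers_le (G := N ≃ₐ[ℚ] N)).mpr (MulAction.mem_stabilizer_iff.mpr hσζ)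
    exact MulAction.mem_stabilizer_iff.mp (hst hg)
  have hx' := hle hx
  rw [IntermediateField.mem_fixedField_iff] at hx'
  exact hx' σ (Subgroup.mem_zpowers σ)

omit [IsGalois ℚ N] in
/-- Conversely an element of `Gal(N/ℚ(ζ))` fixes `ζ`. [folklore] -/
theorem genus_apply_zeta_of_mem {ζ : N} {g : N ≃ₐ[ℚ] N} (hg : g ∈ (ℚ⟮ζ⟯).fixingSubgroup) :
    g ζ = ζ :=
  (IntermediateField.mem_fixingSubgroup_iff _ _).mp hg ζ (IntermediateField.mem_adjoin_simple_self ℚ ζ)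

/-- `σ³ = 1` for `σ ∈ Gal(N/ℚ(ζ))`, a group of order `3`. [folklore] -/
theorem genus_pow_three (hN : Module.finrank ℚ N = 6) {ζ : N} (hζ : IsPrimitiveRoot ζ 3)
    {σ : N ≃ₐ[ℚ] N} (hσζ : σ ζ = ζ) : σ ^ 3 = 1 := by
  have h := pow_card_eq_one' (G := (ℚ⟮ζ⟯).fixingSubgroup) (x := ⟨σ, genus_mem_fixingSubgroup hσζ⟩)
  rw [genus_card_fixingSubgroup hN hζ] at h
  exact congrArg Subtype.val h

/-- `σ (σ (σ x)) = x`. [folklore] -/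
theorem genus_apply_apply_apply (hN : Module.finrank ℚ N = 6) {ζ : N} (hζ : IsPrimitiveRoot ζ 3)
    {σ : N ≃ₐ[ℚ] N} (hσζ : σ ζ = ζ) (x : N) : σ (σ (σ x)) = x := by
  have h := genus_pow_three hN hζ hσζ
  have : (σ ^ 3) x = x := by rw [h, AlgEquiv.one_apply]
  simpa [pow_succ, AlgEquiv.mul_apply] using this

/-- `σ ≠ 1` in a group of order `3` has order `3`. [folklore] -/
theorem genus_orderOf (hN : Module.finrank ℚ N = 6) {ζ : N} (hζ : IsPrimitiveRoot ζ 3)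
    {σ : N ≃ₐ[ℚ] N} (hσζ : σ ζ = ζ) (hσ1 : σ ≠ 1) : orderOf σ = 3 := by
  haveI : Fact (Nat.Prime 3) := ⟨Nat.prime_three⟩
  exact orderOf_eq_prime (genus_pow_three hN hζ hσζ) hσ1

/-- `Gal(N/ℚ(ζ)) = ⟨σ⟩`. [folklore] -/
theorem genus_fixingSubgroup_eq_zpowers (hN : Module.finrank ℚ N = 6) {ζ : N}
    (hζ : IsPrimitiveRoot ζ 3) {σ : N ≃ₐ[ℚ] N} (hσζ : σ ζ = ζ) (hσ1 : σ ≠ 1) :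
    (ℚ⟮ζ⟯).fixingSubgroup = Subgroup.zpowers σ := by
  symm
  apply Subgroup.eq_of_le_of_card_ge
  · exact (Subgroup.zpowers_le (G := N ≃ₐ[ℚ] N)).mpr (genus_mem_fixingSubgroup hσζ)
  · rw [genus_card_fixingSubgroup hN hζ, Nat.card_zpowers, genus_orderOf hN hζ hσζ hσ1]

/-- The `σ`-fixed elements of `N` lie in `ℚ(ζ)`. [folklore] -/
theorem genus_mem_adjoin_of_fixed (hN : Module.finrank ℚ N = 6) {ζ : N} (hζ : IsPrimitiveRoot ζ 3)
    {σ : N ≃ₐ[ℚ] N} (hσζ : σ ζ = ζ) (hσ1 : σ ≠ 1) {x : N} (hx : σ x = x) : x ∈ ℚ⟮ζ⟯ := by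
  rw [← IsGalois.fixedField_fixingSubgroup ℚ⟮ζ⟯, IntermediateField.mem_fixedField_iff,
    genus_fixingSubgroup_eq_zpowers hN hζ hσζ hσ1]
  intro g hg
  have hst : Subgroup.zpowers σ ≤ MulAction.stabilizer (N ≃ₐ[ℚ] N) x :=
    (Subgroup.zpowers_le (G := N ≃ₐ[ℚ] N)).mpr (MulAction.mem_stabilizer_iff.mpr hx)
  exact MulAction.mem_stabilizer_iff.mp (hst hg)

omit [IsGalois ℚ N] in
/-- Elements of `ℚ(ζ)` are `σ`-fixed. [folklore] -/
theorem genus_fixed_of_mem_adjoin {ζ : N} {σ : N ≃ₐ[ℚ] N} (hσζ : σ ζ = ζ) {x : N} (hx : x ∈ ℚ⟮ζ⟯) :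
    σ x = x :=
  (IntermediateField.mem_fixingSubgroup_iff _ _).mp (genus_mem_fixingSubgroup hσζ) x hx

/-! ### `N / ℚ(ζ)` as a cyclic cubic extension: generator, norm, Hilbert 90 -/

/-- The three elements `1, σ, σ²` of `Gal(N/ℚ)` are distinct and exhaust `Gal(N/ℚ(ζ))`; packaged:
an `F`-automorphism `τ` of `N` (`F = ℚ(ζ)`) acting as `σ` and generating `Gal(N/F)`. [folklore] -/
theorem genus_exists_algEquiv (hN : Module.finrank ℚ N = 6) {ζ : N} (hζ : IsPrimitiveRoot ζ 3)
    {σ : N ≃ₐ[ℚ] N} (hσζ : σ ζ = ζ) (hσ1 : σ ≠ 1) :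
    ∃ τ : N ≃ₐ[ℚ⟮ζ⟯] N, (∀ x : N, τ x = σ x) ∧ ∀ g : N ≃ₐ[ℚ⟮ζ⟯] N, g ∈ Subgroup.zpowers τ := by
  set e := IntermediateField.fixingSubgroupEquiv (ℚ⟮ζ⟯ : IntermediateField ℚ N) with he
  set s : (ℚ⟮ζ⟯).fixingSubgroup := ⟨σ, genus_mem_fixingSubgroup hσζ⟩ with hs
  refine ⟨e s, fun x => rfl, ?_⟩
  -- `⟨σ⟩ = Gal(N/F)` inside the subgroup, then transport along `e`
  have htop : Subgroup.zpowers s = ⊤ := by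
    apply Subgroup.eq_top_of_card_eq
    rw [Nat.card_zpowers, genus_card_fixingSubgroup hN hζ]
    have : orderOf s = orderOf σ := (Subgroup.orderOf_mk σ _)
    rw [this, genus_orderOf hN hζ hσζ hσ1]
  intro g
  have hg : e.symm g ∈ Subgroup.zpowers s := by rw [htop]; exact Subgroup.mem_top _
  obtain ⟨k, hk⟩ := Subgroup.mem_zpowers_iff.mp hg
  refine Subgroup.mem_zpowers_iff.mpr ⟨k, ?_⟩
  rw [← map_zpow, hk, MulEquiv.apply_symm_apply]

/-- `Gal(N/ℚ(ζ))` is cyclic. [folklore] -/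
theorem genus_isCyclic (hN : Module.finrank ℚ N = 6) {ζ : N} (hζ : IsPrimitiveRoot ζ 3)
    {σ : N ≃ₐ[ℚ] N} (hσζ : σ ζ = ζ) (hσ1 : σ ≠ 1) : IsCyclic (N ≃ₐ[ℚ⟮ζ⟯] N) := by
  obtain ⟨τ, -, hτ⟩ := genus_exists_algEquiv hN hζ hσζ hσ1
  exact ⟨⟨τ, hτ⟩⟩

/-- **The norm of `N/ℚ(ζ)` is `x ↦ x · σx · σ²x`.** [folklore] -/
theorem genus_norm_eq (hN : Module.finrank ℚ N = 6) {ζ : N} (hζ : IsPrimitiveRoot ζ 3)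
    {σ : N ≃ₐ[ℚ] N} (hσζ : σ ζ = ζ) (hσ1 : σ ≠ 1) (x : N) :
    algebraMap ℚ⟮ζ⟯ N (Algebra.norm ℚ⟮ζ⟯ x) = x * σ x * σ (σ x) := by
  classical
  obtain ⟨τ, hτσ, hτ⟩ := genus_exists_algEquiv hN hζ hσζ hσ1
  rw [Algebra.norm_eq_prod_automorphisms]
  -- `Gal(N/F) = {1, τ, τ²}`
  have hτ1 : τ ≠ 1 := by
    intro h
    apply hσ1
    ext y
    rw [← hτσ, h]; rfl
  have hτ3 : τ ^ 3 = 1 := by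
    ext y
    simp only [pow_succ, pow_zero, one_mul, AlgEquiv.mul_apply, hτσ, AlgEquiv.one_apply]
    exact genus_apply_apply_apply hN hζ hσζ y
  have hτ2 : τ ^ 2 ≠ 1 := by
    intro h
    haveI : Fact (Nat.Prime 3) := ⟨Nat.prime_three⟩
    have h3 : orderOf τ = 3 := orderOf_eq_prime hτ3 hτ1
    have := orderOf_dvd_of_pow_eq_one h
    rw [h3] at this
    omega
  have hτ12 : τ ≠ τ ^ 2 := by
    intro h
    apply hτ1
    have : τ ^ 2 = τ * τ := pow_two τ
    rw [this] at h
    exact (mul_eq_left.mp h.symm)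
  have hcard : Fintype.card (N ≃ₐ[ℚ⟮ζ⟯] N) = 3 := by
    rw [← Nat.card_eq_fintype_card, IsGalois.card_aut_eq_finrank, genus_finrank_top hN hζ]
  have huniv : (Finset.univ : Finset (N ≃ₐ[ℚ⟮ζ⟯] N)) = {1, τ, τ ^ 2} := by
    symm
    apply Finset.eq_univ_of_card
    rw [hcard, Finset.card_insert_of_notMem, Finset.card_insert_of_notMem, Finset.card_singleton]
    · simpa using hτ12
    · simp only [Finset.mem_insert, Finset.mem_singleton, not_or]
      exact ⟨hτ1.symm, hτ2.symm⟩
  rw [huniv, Finset.prod_insert, Finset.prod_insert, Finset.prod_singleton]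
  · simp only [AlgEquiv.one_apply, pow_two, AlgEquiv.mul_apply, hτσ]
    ring
  · simpa using hτ12
  · simp only [Finset.mem_insert, Finset.mem_singleton, not_or]
    exact ⟨hτ1.symm, hτ2.symm⟩

/-- **Hilbert 90 for `N/ℚ(ζ)`**: an element of norm `x · σx · σ²x = 1` is `y / σ y`. [folklore] -/
theorem genus_hilbert90 (hN : Module.finrank ℚ N = 6) {ζ : N} (hζ : IsPrimitiveRoot ζ 3)
    {σ : N ≃ₐ[ℚ] N} (hσζ : σ ζ = ζ) (hσ1 : σ ≠ 1) {x : N} (hx : x * σ x * σ (σ x) = 1) :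
    ∃ y : N, y ≠ 0 ∧ y / σ y = x := by
  obtain ⟨τ, hτσ, hτ⟩ := genus_exists_algEquiv hN hζ hσζ hσ1
  haveI : IsCyclic (N ≃ₐ[ℚ⟮ζ⟯] N) := ⟨⟨τ, hτ⟩⟩
  have hnorm : Algebra.norm ℚ⟮ζ⟯ x = 1 := by
    apply (algebraMap ℚ⟮ζ⟯ N).injective
    rw [genus_norm_eq hN hζ hσζ hσ1, hx, map_one]
  obtain ⟨y, hy⟩ := groupCohomology.exists_div_of_norm_eq_one hτ hnorm
  refine ⟨y, y.ne_zero, ?_⟩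
  rw [← hτσ]; exact hy

/-! ### The norm map and the obstruction `ζ ∉ N(Nˣ)` -/

omit [IsGalois ℚ N] in
/-- The norm `x ↦ x · σx · σ²x` is multiplicative. [folklore] -/
theorem genus_norm_mul (σ : N ≃ₐ[ℚ] N) (x y : N) :
    (x * y) * σ (x * y) * σ (σ (x * y)) = (x * σ x * σ (σ x)) * (y * σ y * σ (σ y)) := by
  simp only [map_mul]; ring

omit [IsGalois ℚ N] in
/-- `N(-1) = -1`. [folklore] -/
theorem genus_norm_neg_one (σ : N ≃ₐ[ℚ] N) :
    ((-1 : N) * σ (-1) * σ (σ (-1))) = -1 := by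
  simp only [map_neg, map_one]; ring

omit [IsGalois ℚ N] in
/-- From `ζ ∉ N(Nˣ)`: no norm is a primitive cube or sixth root of unity, i.e. a norm that is a
sixth root of unity is `±1`. [folklore] -/
theorem genus_norm_ne_of_ne_zeta {ζ : N} (hζ : ζ ^ 2 + ζ + 1 = 0) (σ : N ≃ₐ[ℚ] N)
    (hnorm : ∀ x : N, x * σ x * σ (σ x) ≠ ζ) (x : N) :
    x * σ x * σ (σ x) ≠ ζ ^ 2 ∧ x * σ x * σ (σ x) ≠ -ζ ∧ x * σ x * σ (σ x) ≠ -ζ ^ 2 := by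
  have h3 := genus_zeta_pow_three hζ
  have hsq : ∀ y : N, (y ^ 2) * σ (y ^ 2) * σ (σ (y ^ 2)) = (y * σ y * σ (σ y)) ^ 2 := by
    intro y; simp only [map_pow]; ring
  have h4 : ∀ y : N, (y ^ 4) * σ (y ^ 4) * σ (σ (y ^ 4)) = (y * σ y * σ (σ y)) ^ 4 := by
    intro y; simp only [map_pow]; ring
  refine ⟨fun h => ?_, fun h => ?_, fun h => ?_⟩
  · apply hnorm (x ^ 2)
    rw [hsq, h]
    calc (ζ ^ 2) ^ 2 = ζ ^ 3 * ζ := by ring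
      _ = ζ := by rw [h3, one_mul]
  · apply hnorm (x ^ 4)
    rw [h4, h]
    calc (-ζ) ^ 4 = ζ ^ 3 * ζ := by ring
      _ = ζ := by rw [h3, one_mul]
  · apply hnorm (x ^ 2)
    rw [hsq, h]
    calc (-ζ ^ 2) ^ 2 = ζ ^ 3 * ζ := by ring
      _ = ζ := by rw [h3, one_mul]

/-! ### The `σ`-fixed units of `𝓞 N` are the units `±ζ^i` of `ℤ[ζ]` -/

omit [IsGalois ℚ N] in
/-- An element of a subfield that is integral over `ℤ` in `N` is integral in the subfield.
[folklore] -/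
theorem genus_isIntegral_of_coe {F : IntermediateField ℚ N} (x : F) (hx : IsIntegral ℤ (x : N)) :
    IsIntegral ℤ x :=
  (isIntegral_algHom_iff (IsScalarTower.toAlgHom ℤ F N) Subtype.val_injective).mp hx

/-- **A `σ`-fixed unit of `𝓞 N` is `±ζ^r`** (it lies in `ℚ(ζ)`, hence is a unit of `ℤ[ζ]`;
Mathlib's `IsCyclotomicExtension.Rat.Three.Units.mem`).  Stated for `x ∈ N` with `x` and `x⁻¹`
integral. [folklore] -/
theorem genus_fixed_unit (hN : Module.finrank ℚ N = 6) {ζ : N} (hζ : IsPrimitiveRoot ζ 3)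
    {σ : N ≃ₐ[ℚ] N} (hσζ : σ ζ = ζ) (hσ1 : σ ≠ 1) {x : N} (hx0 : x ≠ 0) (hxi : IsIntegral ℤ x)
    (hxi' : IsIntegral ℤ x⁻¹) (hx : σ x = x) :
    ∃ r < 3, x = ζ ^ r ∨ x = -ζ ^ r := by
  set F : IntermediateField ℚ N := ℚ⟮ζ⟯ with hF
  have hxF : x ∈ F := genus_mem_adjoin_of_fixed hN hζ hσζ hσ1 hx
  have hxF' : x⁻¹ ∈ F := inv_mem hxF
  -- the corresponding unit of `𝓞 F`
  set a : 𝓞 F := ⟨⟨x, hxF⟩, genus_isIntegral_of_coe _ hxi⟩ with ha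
  set b : 𝓞 F := ⟨⟨x⁻¹, hxF'⟩, genus_isIntegral_of_coe _ hxi'⟩ with hb
  have hab : a * b = 1 := by
    apply RingOfIntegers.coe_injective
    apply Subtype.val_injective
    change x * x⁻¹ = 1
    exact mul_inv_cancel₀ hx0
  set uF : (𝓞 F)ˣ := Units.mkOfMulEqOne a b hab with huF
  -- `F = ℚ(ζ)` is the third cyclotomic field
  have hζF : IsPrimitiveRoot (⟨ζ, IntermediateField.mem_adjoin_simple_self ℚ ζ⟩ : F) 3 :=
    IsPrimitiveRoot.coe_submonoidClass_iff.mp hζ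
  haveI := genus_isCyclotomicExtension hζ
  have hmem := IsCyclotomicExtension.Rat.Three.Units.mem hζF uF
  -- read the six cases back in `N` through `ψ : 𝓞 F → N`
  set ψ : 𝓞 F →+* N := (algebraMap F N).comp (algebraMap (𝓞 F) F) with hψ
  have hψu : ψ (uF : 𝓞 F) = x := rfl
  have hψη : ψ (((IsPrimitiveRoot.isUnit (hζF.toInteger_isPrimitiveRoot) (by decide)).unit :
      (𝓞 F)ˣ) : 𝓞 F) = ζ := by
    rw [IsUnit.unit_spec]; rfl
  have key : ∀ v : (𝓞 F)ˣ, uF = v → x = ψ (v : 𝓞 F) := by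
    rintro v rfl; exact hψu.symm
  simp only [List.mem_cons, List.not_mem_nil, or_false] at hmem
  rcases hmem with h | h | h | h | h | h <;> have hk := key _ h
  · exact ⟨0, by norm_num, Or.inl (by rw [hk, Units.val_one, map_one, pow_zero])⟩
  · exact ⟨0, by norm_num, Or.inr (by rw [hk, Units.val_neg, Units.val_one, map_neg, map_one,
      pow_zero])⟩
  · exact ⟨1, by norm_num, Or.inl (by rw [hk, hψη, pow_one])⟩
  · exact ⟨1, by norm_num, Or.inr (by rw [hk, Units.val_neg, map_neg, hψη, pow_one])⟩
  · exact ⟨2, by norm_num, Or.inl (by rw [hk, Units.val_pow_eq_pow_val, map_pow, hψη])⟩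
  · exact ⟨2, by norm_num, Or.inr (by rw [hk, Units.val_neg, Units.val_pow_eq_pow_val, map_neg,
      map_pow, hψη])⟩

/-! ### Summary (registered anchor of this helper file) -/

omit [IsGalois ℚ N] in
/-- **Hilbert 90 for the cyclic cubic extension `N/ℚ(ζ)`, explicit form** (all hypotheses
spelled out; the registered anchor statement of this helper file): in a Galois number field of
degree `6` with `ζ² + ζ + 1 = 0` and `σ ≠ 1` fixing `ζ`, every `x` with `x · σx · σ²x = 1` is of the
form `y / σ y`. [folklore] -/
theorem genus_hilbert90_explicit (N : Type) [Field N] [NumberField N] [IsGalois ℚ N]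
    (hN : Module.finrank ℚ N = 6) (ζ : N) (hζ : ζ ^ 2 + ζ + 1 = 0) (σ : N ≃ₐ[ℚ] N)
    (hσζ : σ ζ = ζ) (hσ1 : σ ≠ 1) (x : N) (hx : x * σ x * σ (σ x) = 1) :
    ∃ y : N, y ≠ 0 ∧ y / σ y = x :=
  genus_hilbert90 hN (genus_isPrimitiveRoot hζ) hσζ hσ1 hx

end Summit.QuantumAdvantage.QuantumAdvantage.Theorems.LinnikCubicClassGroups
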